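import Summits.BirchSwinnertonDyer.BirchSwinnertonDyer.Theorems.PrintCf2RamifiedOffTYZSquareSilenceWitnesses
import Summits.BirchSwinnertonDyer.BirchSwinnertonDyer.Theorems.PrintCf2RamifiedOffTYZLowerHalfTwoPrimesEven
import HarnessLib

/-!
# Crux `PrintCf2.RamifiedOffTYZOfFacts` (stmt-BirchSwinnertonDyer-20509), line `offtyz-v7`, LEAD cycle 13 (cruxlead-20509 g12):
# COEFFICIENT-AWARE SQUARE SILENCE ON THE STABILISER AND THE LOWER HALF, every `k`, even and odd `n` (sequel of `…SquareSilenceWitnesses`)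

THEOREMS ONLY (no `def`, no named fact, no `sorry`), `--supports stmt-BirchSwinnertonDyer-20509` (C⁺ = item 23431, residual 23432).  The general
mechanism of this cycle in usable form.  In g7/g8's square formulae a CM block `D ∣ n` contributes `coefficient × ι_D(g)`; on the stabiliser of `i`
(and `√−2`) the indicator `ι_D(g)` vanishes when `D` is `p` / `2p` (automatic), or carries a WITNESS (transfer lemma, p732749), and the TERM is even
when the coefficient is: for `n ≡ 6 (mod 8)` a proper even block `D ≡ 6` enters ONLY the single chain, with coefficient `|𝓛(n/D)|` (Thm 1.1 / Smith /
Monsky decide its parity: `𝓛(m)` odd iff `#Sel₂(E_m) = 4`), while odd blocks `≡ 5` enter the chains (they are asked to be prime or witnessed).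
* §1 `galPt_sq_genusPoint_eq_of_coefficients_even`: `n ≡ 6 (8)`; top witness; proper even blocks: `2p` ∨ witness ∨ `Even 𝓛(n/D)`; odd blocks `≡ 5`:
  prime ∨ witness ⟹ `g·g·P(n) = P(n)` for every `g` fixing `i`, `√−2`.
* §2 `galPt_sq_genusPoint_eq_of_coefficients_odd`: `n ≡ 5, 7 (8)`; top (if `≡ 5`): prime ∨ witness; proper blocks `≡ 5`: prime ∨ witness ∨
  `Even 𝓛(n/D)` ⟹ `g·g·P(n) = P(n)` for every `g` fixing `i`, `√−n`.
* §3 `two_dvd_scriptL_of_coefficients_even/odd_of_x_not_mem`: + analytic rank one, GZK, Thm 3.5, Lemma 3.18, a generator `R = (x, y)` with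
  `x ∉ {±1, ±2, ±n, ±2n}·ℚ^{×2}` (even) / `x ∉ {±1, ±n}·ℚ^{×2}` (odd) ⟹ **`2 ∣ 𝓛(n)`** (g11's doors p729925 / p727254 and half-movers, square
  hypothesis discharged by §1/§2).
Witness sources (by name): single Frobenius elements with (F5) (ty2 p733876 `exists_frobenius_not_mem_of_clauses`, blocks `d ≡ 6`); products of
Frobenius elements are the natural next display use ((F4) is multiplicative).  Coverage (LEAD census instruments/census_prodwit.py, crux workfile
`Lines/offtyz_v7_EvenTwoPrimes.md` §8): on the even jump-one class with k = 3 (`n ≤ 10⁵`, 246 members) the hypotheses of §1 hold with single-prime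
witnesses on ≈ 50 % and with product witnesses on 206/246 = 84 %; k = 2: 132/132.  BSD is not proved by any of this; no class is closed by this file.

References: [cite: TianYuanZhang2017, §3.1 (p0011 L1–L13, L53–L73), Prop. 3.2 (1)(2), Thm. 3.5, Thm. 3.6 (1)(2), Lemma 3.18, proof of Lemma 3.21
(p0020 L27–L63), Thm. 1.1, §1 (p0002 L101–L110)]; [cite: Cox2013, §5.C Lemma 5.19, (5.22), Cor. 5.25, §9.A]; [cite: Darmon2004, Thm. 3.22]; tree: g7/g8
square formulae, g11 doors/half-movers, g12 `…SquareSilenceTwoPrimesEven`, `…SquareSilenceWitnesses`, `…LowerHalfTwoPrimesEven`.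
-/

noncomputable section

open scoped Classical

open WeierstrassCurve WeierstrassCurve.Affine Finset Literature.NumberTheory.EllipticCurves
  Literature.NumberTheory.EllipticCurves.Rank1Residual Summit.BirchSwinnertonDyer.Rank1Residual
  Literature.NumberTheory.EllipticCurves.TianYuanZhang2017
  Literature.NumberTheory.EllipticCurves.TianYuanZhang2017.W2
  Summit.BirchSwinnertonDyer.Rank1Residual.P2.GenusPeriodTransferLayer
  Summit.BirchSwinnertonDyer.Rank1Residual.P2.ThetaDescent
  Summit.BirchSwinnertonDyer.Rank1Residual.P2
  Summit.BirchSwinnertonDyer.PrintCf2.MoverAssembly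
  Summit.BirchSwinnertonDyer.PrintCf2.SquareSilenceEven
  Summit.BirchSwinnertonDyer.PrintCf2.SquareSilenceWitnesses
  Summit.BirchSwinnertonDyer.PrintCf2.LowerHalfDoor
  Summit.BirchSwinnertonDyer.PrintCf2.LowerHalfDoorEven
  Summit.BirchSwinnertonDyer.PrintCf2.LowerHalfTwoPrimesEven

set_option autoImplicit false

namespace Summit.BirchSwinnertonDyer.PrintCf2.SquareSilenceCoefficients

variable {n : ℕ} (D : GenusPointData n)

/-! ## §1 Even `n ≡ 6 (mod 8)`: top witness, proper even blocks by witness OR even cofactor `𝓛`, odd blocks `≡ 5` by witness or primality -/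

/-- **COEFFICIENT-AWARE SQUARE SILENCE ON THE STABILISER, even `n ≡ 6 (mod 8)`.**  `n` square-free; the displayed recursion and CM-point layer;
`g` fixing `i` and `√−2`.  Hypotheses per CM block: (top) a witness for `D = n` (an `L_n(i)`-trivial `e` with `e² ∈ Gal(ℍ′_n/H′_n)`, `e ∉ Gal(ℍ′_n/H_n)`);
(proper even blocks `D ≡ 6`) `D = 2p`, OR a witness, OR `𝓛(n/D)` EVEN (the block enters g8's square formula only through the single chain with
coefficient `|𝓛(n/D)|`); (odd blocks `D ≡ 5`) `D` prime OR a witness.  Then `g·g·P(n) = P(n)`.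
[cite: TianYuanZhang2017, §3.1 (p0011 L1–L13, L53–L73), Prop. 3.2 (1)(2), Thm. 3.6 (1)(2), proof of Lemma 3.21 (p0020 L27–L63)] -/
theorem galPt_sq_genusPoint_eq_of_coefficients_even (hsq : Squarefree n) (h6 : n % 8 = 6) (hrec : D.recursion)
    (z : ℕ → APoint D.H) (Φ : ℕ → Finset (D.H ≃ₐ[ℚ] D.H)) (ΓH ΓH' : ℕ → Subgroup (D.H ≃ₐ[ℚ] D.H))
    (σ : ℕ → (D.H ≃ₐ[ℚ] D.H)) (c : D.H ≃ₐ[ℚ] D.H) (hc : D.ConjSpec c)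
    (hblock : ∀ d ∈ n.divisors, ((d % 8 = 5 ∨ d % 8 = 6) → D.CMBlockSpec d (z d) (Φ d) (ΓH d) (ΓH' d) (σ d) c) ∧
      (d % 8 = 7 → D.SevenBlockSpec d))
    (htop : ∃ e : D.H ≃ₐ[ℚ] D.H, D.TrivialOnL n e ∧ e * e ∈ ΓH' n ∧ e ∉ ΓH n)
    (heven : ∀ d ∈ n.divisors, d % 8 = 6 → d ≠ n →
      (∃ p : ℕ, p.Prime ∧ d = 2 * p) ∨ (∃ e : D.H ≃ₐ[ℚ] D.H, D.TrivialOnL d e ∧ e * e ∈ ΓH' d ∧ e ∉ ΓH d) ∨ Even (D.scriptL (n / d)))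
    (hodd : ∀ d ∈ n.divisors, d % 8 = 5 → d.Prime ∨ (∃ e : D.H ≃ₐ[ℚ] D.H, D.TrivialOnL d e ∧ e * e ∈ ΓH' d ∧ e ∉ ΓH d))
    (g : D.H ≃ₐ[ℚ] D.H) (hgi : g D.im = D.im) (hg2 : g (D.sqrtNeg 2) = D.sqrtNeg 2) :
    D.galPt (g * g) (D.P n) = D.P n := by
  have hn0 : n ≠ 0 := hsq.ne_zero
  have hnn : n ∈ n.divisors := Nat.mem_divisors_self n hn0
  have hdvd_of_rec : ∀ {d d' : ℕ}, d' ∈ recursionIndex d → d' ∣ d := fun hd' =>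
    Nat.dvd_of_mem_divisors (Finset.mem_filter.mp hd').1
  have hmem : ∀ {d : ℕ}, d ∣ n → d ∈ n.divisors := fun hd => Nat.mem_divisors.mpr ⟨hd, hn0⟩
  -- odd blocks `≡ 5`: the indicator vanishes
  have hι5 : ∀ d ∈ n.divisors, d % 8 = 5 → ¬ (g (D.sqrtNeg d) = D.sqrtNeg d ∧ (g * g) ^ gK d * (σ d)⁻¹ ∈ ΓH' d) := by
    rintro d hd h5 ⟨hfix, hχ⟩
    have hd1 : 1 < d := by omega
    rcases hodd d hd h5 with hp | ⟨e, heL, hee, heH⟩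
    · exact chi_eq_zero_of_trivialOnL_of_cmBlockSpec D hd1 ((hblock d hd).1 (Or.inl h5)) (trivialOnL_prime_of_fix D hp hgi hfix) hχ
    · exact not_sqChi_of_trivialOnL_involution D hd hd1 ((hblock d hd).1 (Or.inl h5)) heL hee heH g hχ
  -- the top block
  have hιn : ¬ ((n % 8 = 5 ∨ n % 8 = 6) ∧ g (D.sqrtNeg n) = D.sqrtNeg n ∧ (g * g) ^ gK n * (σ n)⁻¹ ∈ ΓH' n) := by
    rintro ⟨-, -, hχ⟩
    obtain ⟨e, heL, hee, heH⟩ := htop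
    exact not_sqChi_of_trivialOnL_involution D hnn (by omega) ((hblock n hnn).1 (Or.inr h6)) heL hee heH g hχ
  rw [galPt_mul_self_P_eq_add_even D hsq h6 hrec z Φ ΓH ΓH' σ c hc hblock g, if_neg hιn]
  -- chains through blocks `≡ 5`
  have hS2 : ∑ d ∈ recursionIndex n, ∑ d' ∈ (recursionIndex d).filter (fun d' => d' % 8 = 5),
      (D.scriptL (n / d)).natAbs * (D.scriptL (d / d')).natAbs *
        (if (d' % 8 = 5 ∨ d' % 8 = 6) ∧ g (D.sqrtNeg d') = D.sqrtNeg d' ∧ (g * g) ^ gK d' * (σ d')⁻¹ ∈ ΓH' d' then 1 else 0) = 0 := by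
    refine Finset.sum_eq_zero fun d hd => Finset.sum_eq_zero fun d' hd' => ?_
    obtain ⟨hd'r, hd'5⟩ := Finset.mem_filter.mp hd'
    rw [if_neg (fun hh => hι5 d' (hmem ((hdvd_of_rec hd'r).trans (hdvd_of_rec hd))) hd'5 hh.2), mul_zero]
  have hS3 : ∑ d ∈ (recursionIndex n).filter (fun d => d % 2 = 0), ∑ d' ∈ recursionIndex d,
      ∑ e ∈ (recursionIndex d').filter (fun e => e % 8 = 5),
        (D.scriptL (n / d)).natAbs * (D.scriptL (d / d')).natAbs * (D.scriptL (d' / e)).natAbs *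
          (if (e % 8 = 5 ∨ e % 8 = 6) ∧ g (D.sqrtNeg e) = D.sqrtNeg e ∧ (g * g) ^ gK e * (σ e)⁻¹ ∈ ΓH' e then 1 else 0) = 0 := by
    refine Finset.sum_eq_zero fun d hd => Finset.sum_eq_zero fun d' hd' => Finset.sum_eq_zero fun e he => ?_
    obtain ⟨hdr, -⟩ := Finset.mem_filter.mp hd
    obtain ⟨her, he5⟩ := Finset.mem_filter.mp he
    rw [if_neg (fun hh => hι5 e (hmem (((hdvd_of_rec her).trans (hdvd_of_rec hd')).trans (hdvd_of_rec hdr))) he5 hh.2), mul_zero]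
  -- single chains: even by block
  have hS1 : Even (∑ d ∈ recursionIndex n, (D.scriptL (n / d)).natAbs *
      (if (d % 8 = 5 ∨ d % 8 = 6) ∧ g (D.sqrtNeg d) = D.sqrtNeg d ∧ (g * g) ^ gK d * (σ d)⁻¹ ∈ ΓH' d then 1 else 0)) := by
    refine Finset.even_sum _ fun d hd => ?_
    have hdn : d ∈ n.divisors := hmem (hdvd_of_rec hd)
    by_cases hh : (d % 8 = 5 ∨ d % 8 = 6) ∧ g (D.sqrtNeg d) = D.sqrtNeg d ∧ (g * g) ^ gK d * (σ d)⁻¹ ∈ ΓH' d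
    · obtain ⟨h56, hfix, hχ⟩ := hh
      rcases h56 with h5 | h6'
      · exact absurd ⟨hfix, hχ⟩ (hι5 d hdn h5)
      · have hd1 : 1 < d := by omega
        have hgt : 1 < n / d := (Finset.mem_filter.mp hd).2.2.2
        have hdne : d ≠ n := by
          rintro rfl; rw [Nat.div_self (Nat.pos_of_ne_zero hn0)] at hgt; exact lt_irrefl 1 hgt
        rcases heven d hdn h6' hdne with ⟨p, hp, rfl⟩ | ⟨e, heL, hee, heH⟩ | hev
        · have hp2 : p ≠ 2 := by rintro rfl; omega
          exact absurd hχ (chi_eq_zero_of_trivialOnL_of_cmBlockSpec D hd1 ((hblock _ hdn).1 (Or.inr h6'))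
            (trivialOnL_two_mul_prime_of_fix D hsq hp hp2 hdn hgi hg2 hfix))
        · exact absurd hχ (not_sqChi_of_trivialOnL_involution D hdn hd1 ((hblock d hdn).1 (Or.inr h6')) heL hee heH g)
        · rw [if_pos ⟨Or.inr h6', hfix, hχ⟩, mul_one]
          exact Int.natAbs_even.mpr hev
    · rw [if_neg hh, mul_zero]; exact ⟨0, rfl⟩
  obtain ⟨r, hr⟩ := hS1
  rw [hS2, hS3, add_zero, add_zero, zero_add, hr, show r + r = 2 * r by ring, nsmul_tauOne_eq_mod_two,
    Nat.mul_mod_right, zero_smul, add_zero]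

/-! ## §2 Odd `n ≡ 5, 7 (mod 8)` -/

/-- **COEFFICIENT-AWARE SQUARE SILENCE ON THE STABILISER, odd `n ≡ 5, 7 (mod 8)`** (g7's square formula): `g` fixing `i`; (top, if `n ≡ 5`) a
witness for `D = n` or `n` prime (then `g` must also fix `√−n`); (proper blocks `D ≡ 5`) `D` prime, OR a witness, OR `𝓛(n/D)` even.  Then
`g·g·P(n) = P(n)`. [cite: TianYuanZhang2017, §3.1 (p0011 L1–L13, L53–L73), Prop. 3.2 (1), Thm. 3.6 (1), proof of Lemma 3.21 (p0020 L27–L63)] -/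
theorem galPt_sq_genusPoint_eq_of_coefficients_odd (hsq : Squarefree n) (h57 : n % 8 = 5 ∨ n % 8 = 7) (hrec : D.recursion)
    (z : ℕ → APoint D.H) (Φ : ℕ → Finset (D.H ≃ₐ[ℚ] D.H)) (ΓH ΓH' : ℕ → Subgroup (D.H ≃ₐ[ℚ] D.H))
    (σ : ℕ → (D.H ≃ₐ[ℚ] D.H)) (c : D.H ≃ₐ[ℚ] D.H) (hc : D.ConjSpec c)
    (hblock : ∀ d ∈ n.divisors, ((d % 8 = 5 ∨ d % 8 = 6) → D.CMBlockSpec d (z d) (Φ d) (ΓH d) (ΓH' d) (σ d) c) ∧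
      (d % 8 = 7 → D.SevenBlockSpec d))
    (htop : n % 8 = 5 → n.Prime ∨ (∃ e : D.H ≃ₐ[ℚ] D.H, D.TrivialOnL n e ∧ e * e ∈ ΓH' n ∧ e ∉ ΓH n))
    (hodd : ∀ d ∈ n.divisors, d % 8 = 5 → d ≠ n →
      d.Prime ∨ (∃ e : D.H ≃ₐ[ℚ] D.H, D.TrivialOnL d e ∧ e * e ∈ ΓH' d ∧ e ∉ ΓH d) ∨ Even (D.scriptL (n / d)))
    (g : D.H ≃ₐ[ℚ] D.H) (hgi : g D.im = D.im) (hgK : g (D.sqrtNeg n) = D.sqrtNeg n) :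
    D.galPt (g * g) (D.P n) = D.P n := by
  have hn0 : n ≠ 0 := hsq.ne_zero
  have hnn : n ∈ n.divisors := Nat.mem_divisors_self n hn0
  have hdvd_of_rec : ∀ {d d' : ℕ}, d' ∈ recursionIndex d → d' ∣ d := fun hd' =>
    Nat.dvd_of_mem_divisors (Finset.mem_filter.mp hd').1
  have hmem : ∀ {d : ℕ}, d ∣ n → d ∈ n.divisors := fun hd => Nat.mem_divisors.mpr ⟨hd, hn0⟩
  have hιn : ¬ (n % 8 = 5 ∧ g (D.sqrtNeg n) = D.sqrtNeg n ∧ (g * g) ^ gK n * (σ n)⁻¹ ∈ ΓH' n) := by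
    rintro ⟨h5, -, hχ⟩
    have hn1 : 1 < n := by omega
    rcases htop h5 with hp | ⟨e, heL, hee, heH⟩
    · exact chi_eq_zero_of_trivialOnL_of_cmBlockSpec D hn1 ((hblock n hnn).1 (Or.inl h5)) (trivialOnL_prime_of_fix D hp hgi hgK) hχ
    · exact not_sqChi_of_trivialOnL_involution D hnn hn1 ((hblock n hnn).1 (Or.inl h5)) heL hee heH g hχ
  rw [galPt_mul_self_P_eq_add D hsq h57 hrec z Φ ΓH ΓH' σ c hc hblock g, if_neg hιn]
  have hS1 : Even (∑ d ∈ recursionIndex n, (D.scriptL (n / d)).natAbs *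
      (if d % 8 = 5 ∧ g (D.sqrtNeg d) = D.sqrtNeg d ∧ (g * g) ^ gK d * (σ d)⁻¹ ∈ ΓH' d then 1 else 0)) := by
    refine Finset.even_sum _ fun d hd => ?_
    have hdn : d ∈ n.divisors := hmem (hdvd_of_rec hd)
    by_cases hh : d % 8 = 5 ∧ g (D.sqrtNeg d) = D.sqrtNeg d ∧ (g * g) ^ gK d * (σ d)⁻¹ ∈ ΓH' d
    · obtain ⟨h5, hfix, hχ⟩ := hh
      have hd1 : 1 < d := by omega
      have hgt : 1 < n / d := (Finset.mem_filter.mp hd).2.2.2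
      have hdne : d ≠ n := by
        rintro rfl; rw [Nat.div_self (Nat.pos_of_ne_zero hn0)] at hgt; exact lt_irrefl 1 hgt
      rcases hodd d hdn h5 hdne with hp | ⟨e, heL, hee, heH⟩ | hev
      · exact absurd hχ (chi_eq_zero_of_trivialOnL_of_cmBlockSpec D hd1 ((hblock d hdn).1 (Or.inl h5))
          (trivialOnL_prime_of_fix D hp hgi hfix))
      · exact absurd hχ (not_sqChi_of_trivialOnL_involution D hdn hd1 ((hblock d hdn).1 (Or.inl h5)) heL hee heH g)
      · rw [if_pos ⟨h5, hfix, hχ⟩, mul_one]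
        exact Int.natAbs_even.mpr hev
    · rw [if_neg hh, mul_zero]; exact ⟨0, rfl⟩
  obtain ⟨r, hr⟩ := hS1
  rw [zero_add, hr, show r + r = 2 * r by ring, nsmul_tauOne_eq_mod_two, Nat.mul_mod_right, zero_smul, add_zero]

/-! ## §3 The lower half from the coefficient-aware silence (even `n`): door + even half-mover -/

/-- **LOWER HALF from blockwise witnesses / even cofactors, even `n ≡ 6 (mod 8)`**: analytic rank one, GZK, Thm 3.5 main clause, sign choices,
Lemma 3.18; the hypotheses of `galPt_sq_genusPoint_eq_of_coefficients_even`; a generator `R = (x, y)` of `E_n(ℚ)` modulo torsion with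
`x ∉ {±1, ±2, ±n, ±2n}·ℚ^{×2}`.  Then `2 ∣ L` whenever `𝓛(n)² = L²` (g11's even door with its square hypothesis discharged on the even half-mover).
[cite: TianYuanZhang2017, Thm. 3.5 (p0011 L94–L100), Lemma 3.18, §3.1, Prop. 3.2, Thm. 3.6, proof of Lemma 3.21, §1 (p0002 L101–L110)] [cite: Darmon2004, Thm. 3.22] -/
theorem two_dvd_scriptL_of_coefficients_even_of_x_not_mem
    (hGZK : rank_eq_analyticRank_of_analyticRank_le_one) (hsq : Squarefree n) (h6 : n % 8 = 6)
    (hr : haveI := isElliptic_congruentNumberCurve hsq.ne_zero; (congruentNumberCurve n).analyticRank = 1)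
    (hrec : D.recursion) (h35 : D.thm35Main) (hLs : D.scriptLSpec) (h318 : D.lemma318)
    (z : ℕ → APoint D.H) (Φ : ℕ → Finset (D.H ≃ₐ[ℚ] D.H)) (ΓH ΓH' : ℕ → Subgroup (D.H ≃ₐ[ℚ] D.H))
    (σ : ℕ → (D.H ≃ₐ[ℚ] D.H)) (c : D.H ≃ₐ[ℚ] D.H) (hc : D.ConjSpec c)
    (hblock : ∀ d ∈ n.divisors, ((d % 8 = 5 ∨ d % 8 = 6) → D.CMBlockSpec d (z d) (Φ d) (ΓH d) (ΓH' d) (σ d) c) ∧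
      (d % 8 = 7 → D.SevenBlockSpec d))
    (htop : ∃ e : D.H ≃ₐ[ℚ] D.H, D.TrivialOnL n e ∧ e * e ∈ ΓH' n ∧ e ∉ ΓH n)
    (heven : ∀ d ∈ n.divisors, d % 8 = 6 → d ≠ n →
      (∃ p : ℕ, p.Prime ∧ d = 2 * p) ∨ (∃ e : D.H ≃ₐ[ℚ] D.H, D.TrivialOnL d e ∧ e * e ∈ ΓH' d ∧ e ∉ ΓH d) ∨ Even (D.scriptL (n / d)))
    (hodd : ∀ d ∈ n.divisors, d % 8 = 5 → d.Prime ∨ (∃ e : D.H ≃ₐ[ℚ] D.H, D.TrivialOnL d e ∧ e * e ∈ ΓH' d ∧ e ∉ ΓH d))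
    {x y : ℚ} (hxy : (congruentNumberCurve n).toAffine.Nonsingular x y)
    (hgen : haveI := isElliptic_congruentNumberCurve hsq.ne_zero;
      ∀ P, ∃ k : ℤ, IsOfFinAddOrder (P - k • (Point.some x y hxy : (congruentNumberCurve n).toAffine.Point)))
    (hx : ¬ ∃ r : ℚ, x = r ^ 2 ∨ x = -r ^ 2 ∨ x = n * r ^ 2 ∨ x = -(n * r ^ 2))
    (hx2 : ¬ ∃ r : ℚ, x = 2 * r ^ 2 ∨ x = -(2 * r ^ 2) ∨ x = 2 * n * r ^ 2 ∨ x = -(2 * n * r ^ 2)) :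
    ∀ L : ℤ, IsScriptL n L → (2 : ℤ) ∣ L := by
  haveI := isElliptic_congruentNumberCurve hsq.ne_zero
  have hnn : n ∈ n.divisors := Nat.mem_divisors_self n hsq.ne_zero
  obtain ⟨Q₁, hQ₁⟩ := twist_halving hsq hnn D (Point.some x y hxy)
  obtain ⟨g₀, hgi, hg2, hgK, hmoveQ⟩ :=
    LowerHalfTwoPrimesEven.exists_halfMover_even_of_x_not_mem hsq (Nat.dvd_of_mod_eq_zero (by omega)) D hxy hx hx2 hQ₁
  have hsq0 := galPt_sq_genusPoint_eq_of_coefficients_even D hsq h6 hrec z Φ ΓH ΓH' σ c hc hblock htop heven hodd g₀ hgi hg2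
  exact two_dvd_scriptL_of_halfMover_of_sq_eq_even hGZK hsq h6 hr D h35 hLs h318 hgen hQ₁ g₀ hgi hg2 hgK hmoveQ hsq0

/-- **LOWER HALF from blockwise witnesses / even cofactors, odd `n ≡ 5, 7 (mod 8)`** (g11's odd door p727254 and odd half-mover p728706): a generator
`R = (x, y)` with `x ∉ {±1, ±n}·ℚ^{×2}`; then `2 ∣ L` whenever `𝓛(n)² = L²`.
[cite: TianYuanZhang2017, Thm. 3.5 (p0011 L94–L100), Lemma 3.18, §3.1, Prop. 3.2, Thm. 3.6, proof of Lemma 3.21, §1 (p0002 L101–L110)] [cite: Darmon2004, Thm. 3.22] -/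
theorem two_dvd_scriptL_of_coefficients_odd_of_x_not_mem
    (hGZK : rank_eq_analyticRank_of_analyticRank_le_one) (hsq : Squarefree n) (h57 : n % 8 = 5 ∨ n % 8 = 7)
    (hr : haveI := isElliptic_congruentNumberCurve hsq.ne_zero; (congruentNumberCurve n).analyticRank = 1)
    (hrec : D.recursion) (h35 : D.thm35Main) (hLs : D.scriptLSpec) (h318 : D.lemma318)
    (z : ℕ → APoint D.H) (Φ : ℕ → Finset (D.H ≃ₐ[ℚ] D.H)) (ΓH ΓH' : ℕ → Subgroup (D.H ≃ₐ[ℚ] D.H))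
    (σ : ℕ → (D.H ≃ₐ[ℚ] D.H)) (c : D.H ≃ₐ[ℚ] D.H) (hc : D.ConjSpec c)
    (hblock : ∀ d ∈ n.divisors, ((d % 8 = 5 ∨ d % 8 = 6) → D.CMBlockSpec d (z d) (Φ d) (ΓH d) (ΓH' d) (σ d) c) ∧
      (d % 8 = 7 → D.SevenBlockSpec d))
    (htop : n % 8 = 5 → n.Prime ∨ (∃ e : D.H ≃ₐ[ℚ] D.H, D.TrivialOnL n e ∧ e * e ∈ ΓH' n ∧ e ∉ ΓH n))
    (hodd : ∀ d ∈ n.divisors, d % 8 = 5 → d ≠ n →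
      d.Prime ∨ (∃ e : D.H ≃ₐ[ℚ] D.H, D.TrivialOnL d e ∧ e * e ∈ ΓH' d ∧ e ∉ ΓH d) ∨ Even (D.scriptL (n / d)))
    {x y : ℚ} (hxy : (congruentNumberCurve n).toAffine.Nonsingular x y)
    (hgen : haveI := isElliptic_congruentNumberCurve hsq.ne_zero;
      ∀ P, ∃ k : ℤ, IsOfFinAddOrder (P - k • (Point.some x y hxy : (congruentNumberCurve n).toAffine.Point)))
    (hx : ¬ ∃ r : ℚ, x = r ^ 2 ∨ x = -r ^ 2 ∨ x = n * r ^ 2 ∨ x = -(n * r ^ 2)) :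
    ∀ L : ℤ, IsScriptL n L → (2 : ℤ) ∣ L := by
  haveI := isElliptic_congruentNumberCurve hsq.ne_zero
  have hnn : n ∈ n.divisors := Nat.mem_divisors_self n hsq.ne_zero
  obtain ⟨Q₁, hQ₁⟩ := twist_halving hsq hnn D (Point.some x y hxy)
  obtain ⟨g₀, hgi, hgK, hmoveQ⟩ := HalfMover.exists_halfMover_of_x_not_mem hsq D hxy hx hQ₁
  have hsq0 := galPt_sq_genusPoint_eq_of_coefficients_odd D hsq h57 hrec z Φ ΓH ΓH' σ c hc hblock htop hodd g₀ hgi hgK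
  exact two_dvd_scriptL_of_halfMover_of_sq_eq hGZK hsq h57 hr D h35 hLs h318 hgen hQ₁ g₀ hgi hgK hmoveQ hsq0

end Summit.BirchSwinnertonDyer.PrintCf2.SquareSilenceCoefficients

end
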